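import Literature.Analysis.FluidPDE.NSCriticalClosureBesovExponent
import Literature.Analysis.FluidPDE.CheskidovShvydkoyRegularProofs
import HarnessLib

/-!
# The critical Besov continuation criterion — dependency record with Tao's local theory discharged

Analysis/FluidPDE assembly file (proofs only: no definitions, no named facts, no statement of the
tree is changed) for the named fact
`Literature.Analysis.FluidPDE.hasSmoothExtensionPast_of_eHomBesovNorm_bounded`
(`NSCriticalClosure.lean`; Gallagher–Koch–Planchon 2016, Thm. 1, in contrapositive form for
classical Leray–Hopf solutions from rapidly decaying data: a bounded critical Besov norm
`Ḃ^{-1+3/r}_{r,q}`, `3 < r, q < ∞`, on `[0, T)` gives a smooth extension past `T`).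

State before this file. `NSCriticalClosureBesovRecord.lean` derives the fact from the three named
facts `gkp_besov_blowup` (GKP Thm. 1), `tao2011_smooth_local_existence` (Tao 2013, Thm. 5.4
(ii)+(iv)) and (L) `knss2009_local_smoothing ℝ³` (Koch–Nadirashvili–Seregin–Šverák 2009, Prop. 4.1,
short-time form); `NSCriticalClosureBesovExponent.lean` derives it from GKP Thm. 1 in the exponent
classes `p = q = 3·2^k - 2`, Tao's Thm. 5.4 and (L). Meanwhile Tao's
Thm. 5.4 (ii)+(iv) has been **discharged**: `tao2011_smooth_local_existence_holds`
(`CheskidovShvydkoyRegularProofs.lean`, the Fourier-side `X¹` Picard iteration).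

What this file records. Feeding that discharge in, the continuation criterion now rests on
`hasSmoothExtensionPast_of_eHomBesovNorm_bounded_of_gkp_knssLocal`: the **two** named facts
`gkp_besov_blowup` and `knss2009_local_smoothing ℝ³`; equivalently (`…_of_and2`) their conjunction.
(An earlier version also recorded `…_of_gkpProps3_knssLocal` / `…_of_and_gkpProps3_knssLocal`: the
four named facts `gkp_exists_criticalElement`, `gkp_criticalElement_tendsto_zero`, `gkp_rigidity`
— GKP Props. 2.1–2.3 in the exponent classes — and `knss2009_local_smoothing ℝ³`. The tree-class
rendering `gkp_rigidity` of Prop. 2.3 was merged back into the proof obligation of Thm. 1 on review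
(2026-08-15, D-0026: mis-stated over the tree's class, Step 3 of the printed proof by
contradiction, and a corollary of `gkp_besov_blowup` itself, `gkp_rigidity_of_gkp_besov_blowup`), so
Prop. 2.3 is no longer a named fact of the tree and that record — a one-line composition of
`hasSmoothExtensionPast_of_eHomBesovNorm_bounded_of_gkpExponent_knss`
(`NSCriticalClosureBesovExponent.lean`) with `limsup_eq_top_of_isGKPExponent`, which keeps the
statement of Prop. 2.3 as an explicit hypothesis — is dropped.)

Everything else in the chain (Tao 2013 Cor. 11.1, Cor. 4.3, Thm. 5.4; the Littlewood–Paley and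
Besov-embedding facts; KNSS (A), (R), (C); the gluing of classical solutions) is a theorem of the
tree; `#print axioms` of the theorems below is `propext, Classical.choice, Quot.sound`.
No alternative chain avoiding GKP Thm. 1 is known: the `L³` criterion (Escauriaza–Seregin–Šverák)
does not apply since `Ḃ^{-1+3/r}_{r,q} ⊋ L³` for `r > 3`, and the bounded critical norm cannot be
interpolated with the (supercritical) energy class into a Ladyzhenskaya–Prodi–Serrin class.

## Mathlib / tree search

`lean search 'gkp_besov_blowup_holds|knss2009_local_smoothing_holds'`: absent (2026-08-15).
`tao2011_smooth_local_existence_holds`: `CheskidovShvydkoyRegularProofs.lean`. Mathlib: no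
Navier–Stokes theory.

## References

* I. Gallagher, G. S. Koch, F. Planchon, *Blow-up of critical Besov norms at a potential
  Navier–Stokes singularity*, Comm. Math. Phys. 343 (2016) 39–82 = arXiv:1407.4156, Thm. 1 (p. 5),
  §2.1 (Props. 2.1–2.3). [GKP2016]
* T. Tao, *Localisation and compactness properties of the Navier–Stokes global regularity
  problem*, Anal. PDE 6 (2013) 25–107 = arXiv:1108.1165, Thm. 5.4. [Tao2011]
* G. Koch, N. Nadirashvili, G. Seregin, V. Šverák, *Liouville theorems for the Navier–Stokes
  equations and applications*, Acta Math. 203 (2009) 83–105 = arXiv:0709.3599, Prop. 4.1.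
  [KochNadirashviliSereginSverak2009]
-/

noncomputable section

namespace Literature.Analysis.FluidPDE

-- `linter.deprecated` is switched off for the next declaration only: it names the deprecated
-- (mis-stated, 2026-08-15) tree-class rendering(s) of GKP Thm. 1 (`gkp_besov_blowup`,
-- `CriticalRegularity.lean`), kept unchanged for their users until the faithful path-space forms
-- are vendored (see those files).
set_option linter.deprecated false in
/-- **The critical Besov continuation criterion from GKP's Theorem 1 and the KNSS local smoothing
theory alone** (GKP 2016, Thm. 1, contrapositive; identification of the classical solution with a
Besov mild solution through Tao 2013 — now entirely proved — and smoothing of its bounded Besov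
mild extensions through KNSS 2009, Prop. 4.1): `hasSmoothExtensionPast_of_eHomBesovNorm_bounded`
follows from the named facts `gkp_besov_blowup` and `knss2009_local_smoothing ℝ³`. Proof:
`hasSmoothExtensionPast_of_eHomBesovNorm_bounded_of_gkp_taoLocal_knssLocal` with Tao's Thm. 5.4
(ii)+(iv) supplied by its discharge `tao2011_smooth_local_existence_holds`. [cite: GKP2016, Thm. 1] -/
theorem hasSmoothExtensionPast_of_eHomBesovNorm_bounded_of_gkp_knssLocal (hG : gkp_besov_blowup)
    (hL : knss2009_local_smoothing (EuclideanSpace ℝ (Fin 3))) :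
    hasSmoothExtensionPast_of_eHomBesovNorm_bounded :=
  hasSmoothExtensionPast_of_eHomBesovNorm_bounded_of_gkp_taoLocal_knssLocal hG
    tao2011_smooth_local_existence_holds hL

-- `linter.deprecated` is switched off for the next declaration only: it names the deprecated
-- (mis-stated, 2026-08-15) tree-class rendering(s) of GKP Thm. 1 (`gkp_besov_blowup`,
-- `CriticalRegularity.lean`), kept unchanged for their users until the faithful path-space forms
-- are vendored (see those files).
set_option linter.deprecated false in
/-- **The route's dependency record, updated** (2026-08-15): the continuation criterion holds as
soon as the two named facts GKP Thm. 1 and KNSS (L) are discharged; stated as the implication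
from their conjunction. [cite: GKP2016, Thm. 1] -/
theorem hasSmoothExtensionPast_of_eHomBesovNorm_bounded_of_and2
    (h : gkp_besov_blowup ∧ knss2009_local_smoothing (EuclideanSpace ℝ (Fin 3))) :
    hasSmoothExtensionPast_of_eHomBesovNorm_bounded :=
  hasSmoothExtensionPast_of_eHomBesovNorm_bounded_of_gkp_knssLocal h.1 h.2

end Literature.Analysis.FluidPDE

end
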